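import Mathlib
import Summits.AnomalousDissipation.AnomalousDissipation.Theses.PointSink
import Summits.AnomalousDissipation.AnomalousDissipation.Theorems.SolitonTransplant.Negative.PointSinkEnergyFlux

/-!
# `PointSink.SolitonTransplant` (stmt-AnomalousDissipation-19035): the dissipation floor must cross
every shell separating the stirring from the sink

Lead record (line `Sketch`, continuation seat c1; observation (O3) of `LeadAnalysisC1.md`),
companion of `PointSinkEnergyFlux.lean` (`pointSink_flux_add_work_tendsto_zero`: for every
smooth weight `χ` vanishing near the sink, `∫(½‖u_j‖²+p_j)Dχ[u_j] + ∫χ⟪f,u_j⟫ → 0` along any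
family as in the target `X = PointSinkZerothLaw` — steady classical `f`-forced states on `T³`,
`ν_j → 0`, bounded energy, point concentration of the dissipation at `x₀`).

* `pointSink_inwardFlux_eventually_ge` — if moreover `χ = 1` wherever `f ≠ 0` (the weight
  separates the sink from the stirring) and the floor `ε ≤ ν_j‖∇u_j‖₂²` holds, then
  `∫χ⟪f,u_j⟫ = ∫⟪f,u_j⟫ = ν_j‖∇u_j‖₂² ≥ ε` (`CoherentStates.steady_energy_identity`), so for every
  `δ > 0` eventually `−∫(½‖u_j‖²+p_j)Dχ[u_j] ≥ ε − δ`: the floor must CROSS every shell separating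
  `supp f` from the sink as inward flux of `(½‖u‖²+p)u`.
* `pointSink_false_of_fluxless_shell` — consequently the states cannot be asymptotically
  flux-less on such a shell: `∫_{r ≤ dist ≤ R} (‖u_j‖² + |p_j|)‖u_j‖ → 0` on a shell carrying `Dχ`
  (e.g. `u_j → 0` in `L³` and `p_j u_j → 0` in `L¹` there — "rest" in the strong sense) is
  impossible.

Design constraint for the crux's lines: in any scaffold to be realised by such states the collar
between the stirring region and the cone must transmit the full power `ε`; a completion AT REST
outside `B_{r₁}(x₀)` with `f ≡ 0` on a larger ball (the zero-force free-space completion of line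
`Sketch` planted with a disjoint stirring cell) can only be realised by states whose cubic flux
`(½‖u‖²+p)u` stays non-compact on every separating shell — transport by triple correlations alone.
Classification: negative lemma / design constraint (no verdict change). [folklore]
-/

set_option linter.dupNamespace false  -- `Summit.AnomalousDissipation.AnomalousDissipation` is the mandated summit/problem namespace

noncomputable section

open MeasureTheory Metric Filter Topology Set
open scoped InnerProductSpace
open Literature.Analysis.FunctionSpaces Literature.Analysis.FunctionSpaces.Torus

namespace Summit.AnomalousDissipation.AnomalousDissipation.Theorems.SolitonTransplant.Negative

section Shell

open Summit.AnomalousDissipation.AnomalousDissipation.Theorems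

/-- **The dissipation floor must cross every shell separating the stirring from the sink.** In the
setting of `pointSink_flux_add_work_tendsto_zero`, assume moreover the floor `ε ≤ ν_j‖∇u_j‖₂²` and
that the weight equals `1` wherever the force acts (`f x ≠ 0 → χ x = 1`). Then
`∫χ⟪f,u_j⟫ = ∫⟪f,u_j⟫ = ν_j‖∇u_j‖₂² ≥ ε` (steady energy identity), so for every `δ > 0`,
eventually `ε − δ ≤ −∫(½‖u_j‖²+p_j)Dχ[u_j]`: the INWARD flux of `(½‖u‖²+p)u` through the level
sets of `χ` carries (asymptotically) at least the floor. [folklore] -/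
theorem pointSink_inwardFlux_eventually_ge
    (f : UnitAddTorus (Fin 3) → EuclideanSpace ℝ (Fin 3)) (x₀ : UnitAddTorus (Fin 3))
    (ν : ℕ → ℝ) (u : ℕ → UnitAddTorus (Fin 3) → EuclideanSpace ℝ (Fin 3))
    (p : ℕ → UnitAddTorus (Fin 3) → ℝ) (hν : ∀ j, 0 < ν j) (hν0 : Tendsto ν atTop (𝓝 0))
    (hsol : ∀ j, IsClassicalNSSolutionOn Set.univ (ν j) (fun _ => f) (fun _ => u j)
      (fun _ => p j))
    {E : ℝ} (hE : ∀ j, ∫ x, ‖u j x‖ ^ 2 ≤ E)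
    {ε : ℝ} (hfl : ∀ j, ε ≤ ν j * gradNormSq (u j))
    (hconc : ∀ r : ℝ, 0 < r → Tendsto (fun j => ν j *
      ∫ x in {x : UnitAddTorus (Fin 3) | r ≤ dist x x₀}, ∑ i, ‖partialDeriv i (u j) x‖ ^ 2)
      atTop (𝓝 0))
    {χ : UnitAddTorus (Fin 3) → ℝ} (hχ : IsSmooth χ) {r : ℝ} (hr : 0 < r)
    (hχ0 : ∀ x, dist x x₀ < r → χ x = 0) (hχf : ∀ x, f x ≠ 0 → χ x = 1)
    {δ : ℝ} (hδ : 0 < δ) :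
    ∀ᶠ j in atTop, ε - δ ≤ -∫ x, (2⁻¹ * ‖u j x‖ ^ 2 + p j x) * Torus.fderiv χ x (u j x) := by
  have hlim := pointSink_flux_add_work_tendsto_zero f x₀ ν u p hν hν0 hsol hE hconc hχ hr hχ0
  -- the weighted work is the full work, hence `≥ ε`
  have hW : ∀ j, ε ≤ ∫ x, χ x * ⟪f x, u j x⟫_ℝ := by
    intro j
    have hpt : (fun x => χ x * ⟪f x, u j x⟫_ℝ) = fun x => ⟪f x, u j x⟫_ℝ := by
      funext x
      by_cases hx : f x = 0
      · simp [hx]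
      · rw [hχf x hx, one_mul]
    rw [hpt, ← CoherentStates.steady_energy_identity (hsol j)]
    exact hfl j
  have hev : ∀ᶠ j in atTop, |(∫ x, (2⁻¹ * ‖u j x‖ ^ 2 + p j x) * Torus.fderiv χ x (u j x)) +
      ∫ x, χ x * ⟪f x, u j x⟫_ℝ| < δ := by
    have h := (tendsto_zero_iff_abs_tendsto_zero _).1 hlim
    exact h (Iio_mem_nhds hδ)
  filter_upwards [hev] with j hj
  have h1 := (abs_lt.mp hj).2
  linarith [hW j]

/-- **No flux-less separating shell.** In the setting of `pointSink_inwardFlux_eventually_ge` with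
`ε > 0`, suppose the weight is `1` off the ball `B_R(x₀)` (`R < dist x x₀ → χ x = 1`), so that `Dχ`
lives on the shell `S = {r ≤ dist ≤ R}`. Then the states cannot be asymptotically flux-less on
`S`: `∫_S (‖u_j‖² + |p_j|)‖u_j‖ → 0` (for instance `u_j → 0` in `L³(S)` with `p_j u_j → 0` in
`L¹(S)` — "rest" on the shell in the strong sense) is impossible, because it forces the flux
`∫(½‖u_j‖²+p_j)Dχ[u_j] → 0` while the inward flux is eventually `≥ ε/2`. [folklore] -/
theorem pointSink_false_of_fluxless_shell
    (f : UnitAddTorus (Fin 3) → EuclideanSpace ℝ (Fin 3)) (x₀ : UnitAddTorus (Fin 3))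
    (ν : ℕ → ℝ) (u : ℕ → UnitAddTorus (Fin 3) → EuclideanSpace ℝ (Fin 3))
    (p : ℕ → UnitAddTorus (Fin 3) → ℝ) (hν : ∀ j, 0 < ν j) (hν0 : Tendsto ν atTop (𝓝 0))
    (hsol : ∀ j, IsClassicalNSSolutionOn Set.univ (ν j) (fun _ => f) (fun _ => u j)
      (fun _ => p j))
    {E : ℝ} (hE : ∀ j, ∫ x, ‖u j x‖ ^ 2 ≤ E)
    {ε : ℝ} (hε : 0 < ε) (hfl : ∀ j, ε ≤ ν j * gradNormSq (u j))
    (hconc : ∀ r : ℝ, 0 < r → Tendsto (fun j => ν j *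
      ∫ x in {x : UnitAddTorus (Fin 3) | r ≤ dist x x₀}, ∑ i, ‖partialDeriv i (u j) x‖ ^ 2)
      atTop (𝓝 0))
    {χ : UnitAddTorus (Fin 3) → ℝ} (hχ : IsSmooth χ) {r R : ℝ} (hr : 0 < r)
    (hχ0 : ∀ x, dist x x₀ < r → χ x = 0) (hχ1 : ∀ x, R < dist x x₀ → χ x = 1)
    (hχf : ∀ x, f x ≠ 0 → χ x = 1)
    (hrest : Tendsto (fun j => ∫ x in {x : UnitAddTorus (Fin 3) | r ≤ dist x x₀ ∧ dist x x₀ ≤ R},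
      (‖u j x‖ ^ 2 + |p j x|) * ‖u j x‖) atTop (𝓝 0)) :
    False := by
  -- smoothness of the states
  have hu : ∀ j, IsSmooth (u j) := fun j =>
    (hsol j).smooth_velocity.isSmooth_slice (Set.mem_univ (0 : ℝ))
  have hp : ∀ j, IsSmooth (p j) := fun j =>
    (hsol j).smooth_pressure.isSmooth_slice (Set.mem_univ (0 : ℝ))
  -- a bound for the derivative of the weight, which lives on the shell
  have hDc : Continuous (Torus.fderiv χ) := (hχ.isContDiff (by simp)).continuous_fderiv
  obtain ⟨Cd, hCd'⟩ := (isCompact_range hDc.norm).bddAbove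
  have hCd : ∀ x, ‖Torus.fderiv χ x‖ ≤ Cd := fun x => hCd' ⟨x, rfl⟩
  have hCd0 : 0 ≤ Cd := (norm_nonneg _).trans (hCd x₀)
  set S : Set (UnitAddTorus (Fin 3)) := {x | r ≤ dist x x₀ ∧ dist x x₀ ≤ R} with hS_def
  have hSm : MeasurableSet S :=
    ((isClosed_le continuous_const (continuous_id.dist continuous_const)).inter
      (isClosed_le (continuous_id.dist continuous_const) continuous_const)).measurableSet
  have hDS : ∀ x, x ∉ S → Torus.fderiv χ x = 0 := by
    intro x hx
    have hx' : dist x x₀ < r ∨ R < dist x x₀ := by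
      by_contra h
      push Not at h
      exact hx h
    rcases hx' with h | h
    · refine torusFDeriv_eq_zero_of_eventuallyEq (c := (0 : ℝ)) ?_
      have ho : IsOpen {y : UnitAddTorus (Fin 3) | dist y x₀ < r} :=
        isOpen_lt (continuous_id.dist continuous_const) continuous_const
      exact Filter.eventually_of_mem (ho.mem_nhds h) fun y hy => hχ0 y hy
    · refine torusFDeriv_eq_zero_of_eventuallyEq (c := (1 : ℝ)) ?_
      have ho : IsOpen {y : UnitAddTorus (Fin 3) | R < dist y x₀} :=
        isOpen_lt continuous_const (continuous_id.dist continuous_const)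
      exact Filter.eventually_of_mem (ho.mem_nhds h) fun y hy => hχ1 y hy
  -- the flux is dominated by the flux-less quantity
  set FL : ℕ → ℝ := fun j => ∫ x, (2⁻¹ * ‖u j x‖ ^ 2 + p j x) * Torus.fderiv χ x (u j x)
    with hFL_def
  set Q : ℕ → ℝ := fun j => ∫ x in S, (‖u j x‖ ^ 2 + |p j x|) * ‖u j x‖ with hQ_def
  have hQc : ∀ j, Continuous fun x => (‖u j x‖ ^ 2 + |p j x|) * ‖u j x‖ := fun j =>
    (((hu j).continuous.norm.pow 2).add (hp j).continuous.abs).mul (hu j).continuous.norm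
  have hQi : ∀ j, Integrable (fun x => (‖u j x‖ ^ 2 + |p j x|) * ‖u j x‖) volume := fun j =>
    (hQc j).integrable_of_hasCompactSupport (HasCompactSupport.of_compactSpace _)
  have hQ0 : ∀ j x, 0 ≤ (‖u j x‖ ^ 2 + |p j x|) * ‖u j x‖ := fun j x => by positivity
  have hFL : ∀ j, |FL j| ≤ Cd * Q j := by
    intro j
    have hbound : ∀ x, ‖(2⁻¹ * ‖u j x‖ ^ 2 + p j x) * Torus.fderiv χ x (u j x)‖ ≤
        Cd * S.indicator (fun x => (‖u j x‖ ^ 2 + |p j x|) * ‖u j x‖) x := by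
      intro x
      by_cases hx : x ∈ S
      · rw [Set.indicator_of_mem hx, norm_mul, Real.norm_eq_abs, Real.norm_eq_abs]
        have h1 : |2⁻¹ * ‖u j x‖ ^ 2 + p j x| ≤ ‖u j x‖ ^ 2 + |p j x| := by
          calc |2⁻¹ * ‖u j x‖ ^ 2 + p j x| ≤ |2⁻¹ * ‖u j x‖ ^ 2| + |p j x| := abs_add_le _ _
            _ ≤ ‖u j x‖ ^ 2 + |p j x| := by
                rw [abs_of_nonneg (by positivity)]
                nlinarith [sq_nonneg ‖u j x‖]
        have h2 : |Torus.fderiv χ x (u j x)| ≤ Cd * ‖u j x‖ := by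
          calc |Torus.fderiv χ x (u j x)| = ‖Torus.fderiv χ x (u j x)‖ := (Real.norm_eq_abs _).symm
            _ ≤ ‖Torus.fderiv χ x‖ * ‖u j x‖ := ContinuousLinearMap.le_opNorm _ _
            _ ≤ Cd * ‖u j x‖ := mul_le_mul_of_nonneg_right (hCd x) (norm_nonneg _)
        calc |2⁻¹ * ‖u j x‖ ^ 2 + p j x| * |Torus.fderiv χ x (u j x)|
            ≤ (‖u j x‖ ^ 2 + |p j x|) * (Cd * ‖u j x‖) :=
              mul_le_mul h1 h2 (abs_nonneg _) (by positivity)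
          _ = Cd * ((‖u j x‖ ^ 2 + |p j x|) * ‖u j x‖) := by ring
      · rw [Set.indicator_of_notMem hx, hDS x hx]
        simp
    have hint : Integrable (fun x => Cd * S.indicator (fun x => (‖u j x‖ ^ 2 + |p j x|) * ‖u j x‖) x)
        volume := ((hQi j).indicator hSm).const_mul _
    have h := norm_integral_le_of_norm_le hint (ae_of_all _ hbound)
    rw [integral_const_mul, integral_indicator hSm, Real.norm_eq_abs] at h
    exact h
  have hFL0 : Tendsto FL atTop (𝓝 0) := by
    have h : Tendsto (fun j => Cd * Q j) atTop (𝓝 0) := by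
      simpa using hrest.const_mul Cd
    refine squeeze_zero_norm (fun j => ?_) h
    rw [Real.norm_eq_abs]
    exact hFL j
  -- but the inward flux is eventually `≥ ε / 2`
  have hev := pointSink_inwardFlux_eventually_ge f x₀ ν u p hν hν0 hsol hE hfl hconc hχ hr hχ0
    hχf (half_pos hε)
  have hev' : ∀ᶠ j in atTop, |FL j| < ε / 2 :=
    ((tendsto_zero_iff_abs_tendsto_zero _).1 hFL0) (Iio_mem_nhds (half_pos hε))
  obtain ⟨j, hj1, hj2⟩ := (hev.and hev').exists
  have h1 := (abs_lt.mp hj2).1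
  simp only [hFL_def] at h1
  linarith

end Shell

end Summit.AnomalousDissipation.AnomalousDissipation.Theorems.SolitonTransplant.Negative

end
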